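import Summits.KontsevichZagierPeriods.KontsevichZagierPeriods.Theorems.HurwitzMicroSectorsNormalFormPrincipleM3KernelRefs
import Summits.KontsevichZagierPeriods.KontsevichZagierPeriods.Theorems.HurwitzMicroSectorsNormalFormPrincipleM3KernelReduceZeta
import Summits.KontsevichZagierPeriods.KontsevichZagierPeriods.Theorems.HurwitzMicroSectorsNormalFormPrincipleLevelOneBoxPolyExistsPt
import Summits.KontsevichZagierPeriods.KontsevichZagierPeriods.Theorems.MzvKernelInKZ.Negative.ScalingDivision
import Literature.NumberTheory.Transcendental.AperyIrrationality

/-!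
# `NormalFormPrinciple` (stmt-KontsevichZagierPeriods-3869), line `SketchIdeator1` —
# leaf `stub_boxRigidity`, layer `M3` kernel: the `ζ(3)` families AND the polynomial boxes (Apéry)

Pure proof file (lead seat c9; `--supports` the crux). An UNCONDITIONAL instance of Conjecture 1 on
an infinite subgroup whose values span the TWO-dimensional `ℚ`-space `ℚ + ℚζ(3)`: the subgroup of
the formal period group generated by the six `ζ(3)`-valued dimension-three box families of the
capstone (`[□³, k/(1−xyz)]` for `k = 1, 2, 5`, `[□³, 1/((1−xy)(1−xyz))]`, `[□³, 8/((1+xy)(1+xyz))]`,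
`[□³, 16/((2−x)(2−xyz))]`) together with ALL rational polynomial boxes `[□ᵐ, p]`, `p ∈ ℚ[x]`, of
all dimensions `m` (the rational points are `m = 0`). Every element reduces, after doubling, to
`α·[ζ(3) box] + [pt, q]` (`m3k_reduce_zeta`; `LevelOne.boxPoly_exists_pt`, rule (3) integrating
polynomials out); its value is `α ζ(3) + q`; APÉRY's theorem (`Apery.irrational_zeta_three`, proved in
the tree) forces `α = 0`, whence `q = 0`, and the normal form with `α = q = 0` is a relation.
References: M. Kontsevich, D. Zagier, *Periods* (2001), §1.2 (Conjecture 1); R. Apéry, *Astérisque*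
61 (1979). No definitions are introduced.
-/

noncomputable section

open MeasureTheory Set
open Literature.NumberTheory.Transcendental Literature.NumberTheory.Transcendental.KZ
open Summit.KontsevichZagierPeriods.MzvKernelInKZ.Negative (mem_relations_of_nsmul_mem)
open Summit.KontsevichZagierPeriods.HurwitzMicroSectors.NormalFormPrinciple.PiBox.Dlog
  (exists_ptCarrier value_pt pt_add_mem_relations pt_zero_mem_relations pt_congr_mem_relations)
open Summit.KontsevichZagierPeriods.HurwitzMicroSectors.NormalFormPrinciple.PiBox.LevelOne
  (boxPoly_exists_pt)

namespace Summit.KontsevichZagierPeriods.HurwitzMicroSectors.NormalFormPrinciple.PiBox.M3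

/-- **Conjecture 1 UNCONDITIONALLY on the `ζ(3)` families together with all rational polynomial
boxes** (lead seat c9, line `SketchIdeator1`). A formal `ℤ`-combination of representations of the
six `ζ(3)`-valued dimension-three box families and of polynomial boxes `[□ᵐ, p]` (`p ∈ ℚ[x]`, any
`m`) whose value vanishes is a Kontsevich–Zagier relation. The transcendental input is Apéry's
theorem `ζ(3) ∉ ℚ`. [cite: KontsevichZagier2001, §1.2 Conjecture 1] -/
theorem m3ZetaFamiliesPoly_mem_relations_of_eval_eq_zero
    {c : FormalRep}
    (hc : c ∈ AddSubgroup.closure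
      ({y : FormalRep | ∃ N : IntegralRep 3, N.domain = {x | ∀ i, x i ∈ Set.Ioo (0:ℝ) 1} ∧
        EqOn N.integrand (fun x => 1 / (1 - x 0 * x 1 * x 2)) N.domain ∧ y = of N} ∪
      {y : FormalRep | ∃ N : IntegralRep 3, N.domain = {x | ∀ i, x i ∈ Set.Ioo (0:ℝ) 1} ∧
        EqOn N.integrand (fun x => 2 / (1 - x 0 * x 1 * x 2)) N.domain ∧ y = of N} ∪
      {y : FormalRep | ∃ N : IntegralRep 3, N.domain = {x | ∀ i, x i ∈ Set.Ioo (0:ℝ) 1} ∧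
        EqOn N.integrand (fun x => 5 / (1 - x 0 * x 1 * x 2)) N.domain ∧ y = of N} ∪
      {y : FormalRep | ∃ N : IntegralRep 3, N.domain = {x | ∀ i, x i ∈ Set.Ioo (0:ℝ) 1} ∧
        EqOn N.integrand (fun x => 1 / ((1 - x 0 * x 1) * (1 - x 0 * x 1 * x 2))) N.domain ∧ y = of N} ∪
      {y : FormalRep | ∃ N : IntegralRep 3, N.domain = {x | ∀ i, x i ∈ Set.Ioo (0:ℝ) 1} ∧
        EqOn N.integrand (fun x => 8 / ((1 + x 0 * x 1) * (1 + x 0 * x 1 * x 2))) N.domain ∧ y = of N} ∪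
      {y : FormalRep | ∃ N : IntegralRep 3, N.domain = {x | ∀ i, x i ∈ Set.Ioo (0:ℝ) 1} ∧
        EqOn N.integrand (fun x => 16 / ((2 - x 0) * (2 - x 0 * x 1 * x 2))) N.domain ∧ y = of N} ∪
      {y : FormalRep | ∃ (m : ℕ) (p : MvPolynomial (Fin m) ℚ) (N : IntegralRep m),
        N.domain = {x | ∀ i, x i ∈ Set.Ioo (0:ℝ) 1} ∧
        EqOn N.integrand (fun x => (MvPolynomial.aeval x p : ℝ)) N.domain ∧ y = of N}))
    (hv : eval c = 0) : c ∈ relations := by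
  obtain ⟨Z, Q, N7, ⟨hZd, hZi, hZv⟩, ⟨hQd, hQi, hQv⟩, ⟨hN7d, hN7i⟩⟩ := m3k_exists_refs
  obtain ⟨r10, r2, r4, r1, r3, r5⟩ := m3k_reduce_zeta Z Q N7 hZd hZi hQd hQi hN7d hN7i
  obtain ⟨Zf, hZf⟩ := exists_ptCarrier
  -- bookkeeping on the rational points `[pt, q]`
  have hZ0 : of (Zf 0) ∈ relations :=
    pt_zero_mem_relations (Zf 0) (by rw [(hZf 0).2]; push_cast; rfl)
  have hadd : ∀ q q' : ℚ, of (Zf (q + q')) - of (Zf q) - of (Zf q') ∈ relations := fun q q' =>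
    pt_add_mem_relations (Zf (q + q')) (Zf q) (Zf q') (hZf _).1 (hZf _).1 (hZf _).1
      (by rw [(hZf _).2]; push_cast; rfl) (hZf _).2 (hZf _).2
  -- every element of the subgroup reduces, after doubling, to `α·Z + [pt, q]`
  have hred : ∀ c ∈ AddSubgroup.closure
      ({y : FormalRep | ∃ N : IntegralRep 3, N.domain = {x | ∀ i, x i ∈ Set.Ioo (0:ℝ) 1} ∧
        EqOn N.integrand (fun x => 1 / (1 - x 0 * x 1 * x 2)) N.domain ∧ y = of N} ∪
      {y : FormalRep | ∃ N : IntegralRep 3, N.domain = {x | ∀ i, x i ∈ Set.Ioo (0:ℝ) 1} ∧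
        EqOn N.integrand (fun x => 2 / (1 - x 0 * x 1 * x 2)) N.domain ∧ y = of N} ∪
      {y : FormalRep | ∃ N : IntegralRep 3, N.domain = {x | ∀ i, x i ∈ Set.Ioo (0:ℝ) 1} ∧
        EqOn N.integrand (fun x => 5 / (1 - x 0 * x 1 * x 2)) N.domain ∧ y = of N} ∪
      {y : FormalRep | ∃ N : IntegralRep 3, N.domain = {x | ∀ i, x i ∈ Set.Ioo (0:ℝ) 1} ∧
        EqOn N.integrand (fun x => 1 / ((1 - x 0 * x 1) * (1 - x 0 * x 1 * x 2))) N.domain ∧ y = of N} ∪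
      {y : FormalRep | ∃ N : IntegralRep 3, N.domain = {x | ∀ i, x i ∈ Set.Ioo (0:ℝ) 1} ∧
        EqOn N.integrand (fun x => 8 / ((1 + x 0 * x 1) * (1 + x 0 * x 1 * x 2))) N.domain ∧ y = of N} ∪
      {y : FormalRep | ∃ N : IntegralRep 3, N.domain = {x | ∀ i, x i ∈ Set.Ioo (0:ℝ) 1} ∧
        EqOn N.integrand (fun x => 16 / ((2 - x 0) * (2 - x 0 * x 1 * x 2))) N.domain ∧ y = of N} ∪
      {y : FormalRep | ∃ (m : ℕ) (p : MvPolynomial (Fin m) ℚ) (N : IntegralRep m),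
        N.domain = {x | ∀ i, x i ∈ Set.Ioo (0:ℝ) 1} ∧
        EqOn N.integrand (fun x => (MvPolynomial.aeval x p : ℝ)) N.domain ∧ y = of N}),
      ∃ (α : ℤ) (q : ℚ), (2:ℕ) • c - (α • of Z + of (Zf q)) ∈ relations := by
    intro c hc
    induction hc using AddSubgroup.closure_induction with
    | mem y hy =>
      simp only [mem_union, mem_setOf_eq] at hy
      rcases hy with ((((((⟨N, hNd, hNi, rfl⟩ | ⟨N, hNd, hNi, rfl⟩) | ⟨N, hNd, hNi, rfl⟩) | ⟨N, hNd, hNi, rfl⟩) | ⟨N, hNd, hNi, rfl⟩) | ⟨N, hNd, hNi, rfl⟩) | ⟨m, p, N, hNd, hNi, rfl⟩)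
      · refine ⟨2, 0, ?_⟩
        have h := r10 N hNd hNi
        have e : (2:ℕ) • of N - ((2:ℤ) • of Z + of (Zf 0)) =
            ((2:ℕ) • of N - ((2:ℤ) • of Z + (0:ℤ) • of Q)) - of (Zf 0) := by
          simp only [zero_smul, add_zero]; abel
        rw [e]
        exact relations.sub_mem h hZ0
      · refine ⟨4, 0, ?_⟩
        have h := r2 N hNd hNi
        have e : (2:ℕ) • of N - ((4:ℤ) • of Z + of (Zf 0)) =
            ((2:ℕ) • of N - ((4:ℤ) • of Z + (0:ℤ) • of Q)) - of (Zf 0) := by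
          simp only [zero_smul, add_zero]; abel
        rw [e]
        exact relations.sub_mem h hZ0
      · refine ⟨10, 0, ?_⟩
        have h := r4 N hNd hNi
        have e : (2:ℕ) • of N - ((10:ℤ) • of Z + of (Zf 0)) =
            ((2:ℕ) • of N - ((10:ℤ) • of Z + (0:ℤ) • of Q)) - of (Zf 0) := by
          simp only [zero_smul, add_zero]; abel
        rw [e]
        exact relations.sub_mem h hZ0
      · refine ⟨4, 0, ?_⟩
        have h := r1 N hNd hNi
        have e : (2:ℕ) • of N - ((4:ℤ) • of Z + of (Zf 0)) =
            ((2:ℕ) • of N - ((4:ℤ) • of Z + (0:ℤ) • of Q)) - of (Zf 0) := by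
          simp only [zero_smul, add_zero]; abel
        rw [e]
        exact relations.sub_mem h hZ0
      · refine ⟨10, 0, ?_⟩
        have h := r3 N hNd hNi
        have e : (2:ℕ) • of N - ((10:ℤ) • of Z + of (Zf 0)) =
            ((2:ℕ) • of N - ((10:ℤ) • of Z + (0:ℤ) • of Q)) - of (Zf 0) := by
          simp only [zero_smul, add_zero]; abel
        rw [e]
        exact relations.sub_mem h hZ0
      · refine ⟨10, 0, ?_⟩
        have h := r5 N hNd hNi
        have e : (2:ℕ) • of N - ((10:ℤ) • of Z + of (Zf 0)) =
            ((2:ℕ) • of N - ((10:ℤ) • of Z + (0:ℤ) • of Q)) - of (Zf 0) := by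
          simp only [zero_smul, add_zero]; abel
        rw [e]
        exact relations.sub_mem h hZ0
      · obtain ⟨q, hq⟩ := boxPoly_exists_pt p N hNd hNi
        refine ⟨0, q + q, ?_⟩
        have h := hq (Zf q) (hZf q).1 (hZf q).2
        have e : (2:ℕ) • of N - ((0:ℤ) • of Z + of (Zf (q + q))) =
            (of N - of (Zf q)) + (of N - of (Zf q)) -
              (of (Zf (q + q)) - of (Zf q) - of (Zf q)) := by
          simp only [zero_smul, zero_add, two_nsmul]; abel
        rw [e]
        exact relations.sub_mem (relations.add_mem h h) (hadd q q)
    | zero =>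
      refine ⟨0, 0, ?_⟩
      have e : (2:ℕ) • (0:FormalRep) - ((0:ℤ) • of Z + of (Zf 0)) = -of (Zf 0) := by
        simp only [smul_zero, zero_smul, zero_add, zero_sub]
      rw [e]
      exact relations.neg_mem hZ0
    | add y z _ _ ihy ihz =>
      obtain ⟨α₁, q₁, h₁⟩ := ihy
      obtain ⟨α₂, q₂, h₂⟩ := ihz
      refine ⟨α₁ + α₂, q₁ + q₂, ?_⟩
      have e : (2:ℕ) • (y + z) - ((α₁ + α₂) • of Z + of (Zf (q₁ + q₂))) =
          ((2:ℕ) • y - (α₁ • of Z + of (Zf q₁))) + ((2:ℕ) • z - (α₂ • of Z + of (Zf q₂))) -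
            (of (Zf (q₁ + q₂)) - of (Zf q₁) - of (Zf q₂)) := by
        simp only [smul_add, add_smul]; abel
      rw [e]
      exact relations.sub_mem (relations.add_mem h₁ h₂) (hadd q₁ q₂)
    | neg y _ ih =>
      obtain ⟨α, q, h⟩ := ih
      refine ⟨-α, -q, ?_⟩
      have hq0 : of (Zf (q + -q)) ∈ relations :=
        pt_zero_mem_relations _ (by rw [(hZf _).2]; push_cast; ring_nf)
      have e : (2:ℕ) • (-y) - ((-α) • of Z + of (Zf (-q))) =
          -((2:ℕ) • y - (α • of Z + of (Zf q))) + (of (Zf (q + -q)) - of (Zf q) - of (Zf (-q)))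
            - of (Zf (q + -q)) := by
        simp only [smul_neg, neg_smul]; abel
      rw [e]
      exact relations.sub_mem (relations.add_mem (relations.neg_mem h) (hadd q (-q))) hq0
  obtain ⟨α, q, h⟩ := hred c hc
  -- evaluate: `0 = α ζ(3) + q`, and Apéry
  have hev := relations_le_ker_eval_holds h
  rw [AddMonoidHom.mem_ker, map_sub, map_nsmul, map_add, map_zsmul, eval_of, eval_of, hv, hZv,
    value_pt (Zf q) (hZf q).1 (hZf q).2, smul_zero, zero_sub, neg_eq_zero, zsmul_eq_mul] at hev
  have hα : α = 0 := by
    by_contra hα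
    have hα' : (α : ℝ) ≠ 0 := by exact_mod_cast hα
    refine Literature.NumberTheory.Transcendental.Apery.irrational_zeta_three ⟨-q / α, ?_⟩
    push_cast
    field_simp
    linarith
  subst hα
  have hq : q = 0 := by
    have : (q : ℝ) = 0 := by simpa using hev
    exact_mod_cast this
  subst hq
  have e : (2:ℕ) • c = ((2:ℕ) • c - ((0:ℤ) • of Z + of (Zf 0))) + of (Zf 0) := by
    simp only [zero_smul, zero_add]; abel
  refine mem_relations_of_nsmul_mem (by norm_num : 0 < 2) ?_
  rw [e]
  exact relations.add_mem h hZ0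

/-- **Mixed pairs** (lead seat c9): a representation of one of the six `ζ(3)` box families and a
rational polynomial box of any dimension with equal values are KZ-equivalent (vacuously consistent
with Apéry: the values never agree unless both reduce to the zero class). [cite: KontsevichZagier2001, §1.2 Conjecture 1] -/
theorem m3ZetaFamily_equivalent_boxPoly_of_value_eq {m : ℕ} (N : IntegralRep 3) (N' : IntegralRep m)
    (p : MvPolynomial (Fin m) ℚ)
    (hN : of N ∈ ({y : FormalRep | ∃ N : IntegralRep 3, N.domain = {x | ∀ i, x i ∈ Set.Ioo (0:ℝ) 1} ∧
        EqOn N.integrand (fun x => 1 / (1 - x 0 * x 1 * x 2)) N.domain ∧ y = of N} ∪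
      {y : FormalRep | ∃ N : IntegralRep 3, N.domain = {x | ∀ i, x i ∈ Set.Ioo (0:ℝ) 1} ∧
        EqOn N.integrand (fun x => 2 / (1 - x 0 * x 1 * x 2)) N.domain ∧ y = of N} ∪
      {y : FormalRep | ∃ N : IntegralRep 3, N.domain = {x | ∀ i, x i ∈ Set.Ioo (0:ℝ) 1} ∧
        EqOn N.integrand (fun x => 5 / (1 - x 0 * x 1 * x 2)) N.domain ∧ y = of N} ∪
      {y : FormalRep | ∃ N : IntegralRep 3, N.domain = {x | ∀ i, x i ∈ Set.Ioo (0:ℝ) 1} ∧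
        EqOn N.integrand (fun x => 1 / ((1 - x 0 * x 1) * (1 - x 0 * x 1 * x 2))) N.domain ∧ y = of N} ∪
      {y : FormalRep | ∃ N : IntegralRep 3, N.domain = {x | ∀ i, x i ∈ Set.Ioo (0:ℝ) 1} ∧
        EqOn N.integrand (fun x => 8 / ((1 + x 0 * x 1) * (1 + x 0 * x 1 * x 2))) N.domain ∧ y = of N} ∪
      {y : FormalRep | ∃ N : IntegralRep 3, N.domain = {x | ∀ i, x i ∈ Set.Ioo (0:ℝ) 1} ∧
        EqOn N.integrand (fun x => 16 / ((2 - x 0) * (2 - x 0 * x 1 * x 2))) N.domain ∧ y = of N}))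
    (hN'd : N'.domain = {x | ∀ i, x i ∈ Set.Ioo (0:ℝ) 1})
    (hN'i : EqOn N'.integrand (fun x => (MvPolynomial.aeval x p : ℝ)) N'.domain)
    (hval : N.value = N'.value) : Equivalent N N' := by
  refine m3ZetaFamiliesPoly_mem_relations_of_eval_eq_zero (AddSubgroup.sub_mem _
    (AddSubgroup.subset_closure (Or.inl hN))
    (AddSubgroup.subset_closure (Or.inr ⟨m, p, N', hN'd, hN'i, rfl⟩))) ?_
  rw [map_sub, eval_of, eval_of, hval, sub_self]

end Summit.KontsevichZagierPeriods.HurwitzMicroSectors.NormalFormPrinciple.PiBox.M3
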